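import Summits.RiemannHypothesis.RiemannHypothesis.Theorems.TiltedLandingLaw421R3Lens1CoverageB
import Summits.RiemannHypothesis.RiemannHypothesis.Theorems.TiltedLandingLaw421R3ClusterQMP
import Summits.RiemannHypothesis.RiemannHypothesis.Theorems.TiltedLandingLaw421R3LineageQ
import Summits.RiemannHypothesis.RiemannHypothesis.Theorems.TiltedLandingLaw421R3WindowLoss

/-!
# W-08 · lens-1 gen 3 — MODULE S «SIGNED CUTS» v2: the hung-box door, the signed-corner door, the central lineage, and the residual `RegHungS`

Cell rh-split, seat `rh33346-lens-1-g3` (LENS IDEATOR 1; lens = signed-Jensen boundary-sign census) for crux ⟨33346⟩ `TiltedLandingLaw421R`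
(route EarlyAppointments), SUCC side.  SUPPORT only, typed over LANDED modules (`…R3Lens1CoverageB` #1135, `…R3ClusterQMP`, `…R3LineageQ`);
0 `sorry`, no new axioms, no instances, no notation.  HONEST LABEL: nothing here bears on the truth of RH; RH is NOT proved; models ≠ ξ;
⟨33346⟩/⟨33347⟩ stay OPEN (`RegHungS` below is an OPEN statement, a hypothesis of the compositions).

THE OBSERVATION.  The stop `ReadyR2 = CumReady (WindowReady ∨ TiltReady)` books, at every level `j' ≤ j`, every SIGNED window of `f^{(j')}`
in the LAW's range carrying local A and a couple (seam 06 `WindowReady`; `SignWindow` = nine boundary-sign conjuncts ∧ `LocalA` ∧ couple).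
Hence at a NON-Ready′ level ANY signed rectangle of `F = f^{(j)}` in range with a couple inside has ¬ local A for free: an off-axis zero `ρ` of
`f^{(j+1)}` IN THE OPEN BOX — no census, no Rolle identity, no NL event, no Jensen clearance (`offAxisZero_or_windowReady`).  By JENSEN'S
THEOREM at level `j` (tree `jensen_host_levelj`) `ρ` hangs in the closed disc of an upper zero `a` of `F`; if `a` is a level-`j` band point the
Jensen nesting `band_step'` puts `ρ` in the level-`(j+1)` band FOR FREE, so only OUT-OF-BAND hosts whose discs reach into the box need a
clause (`HangClause`).  This is the HUNG-BOX door ★★★ `succ_or_readyR2_of_hungBox`; the tree's corner door `…R3ClusterQMP.succ_or_readyR2_of_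
window_corners` (Jensen-CLEAR `Window` + corner inequality) is the special case `signedCorner_of_cornerWindow` + `hungBox_of_signedCorner`.
Signed ⊋ clear: signed cuts run THROUGH discs — beside a real zero («tooth») and on the midlines of a comb of any density.

CONTENTS.  §1 sockets `SignedRect`, `SignedCorner` · §2 `HangClause`, `HungBox`, ★★★ `succ_or_readyR2_of_hungBox`, `hangClause_of_inBand`
(in-band hosts free), `hangClause_of_corner` + `hungBox_of_signedCorner` ⇒ ★★ `succ_or_readyR2_of_signedCorner` · §3 `signedCorner_of_cornerWindow`
(⊇ tree door A8) · §4 the free top (`jensenClear_of_gt_strip`: above the strip every point is Jensen-clear; `signedRect_of_cuts`: two vertical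
transversals signed on heights `(0, Hs]` span a signed rectangle of height `Hs+1`) · §4b the CENTRAL LINEAGE (state-free): `ColCouple`,
`ColumnCuttable`, ★★ `succ_of_columnCuttable` (one level), ★★ `succ_of_columnCuttable_upTo` (from the booked pair `w₀`) · §5 the residual in
SUCCESSOR currency ★ `RegHungS` := (binders of `AntiEscapeCore` ∧ simple zero ∧ ¬F ∧ ¬N♭ ∧ ¬L-deep) ∧ ¬`HungBox` ⇒ successor,
`antiEscapeCore_of_regHungS`, ★★ `TiltedLandingLaw421R_of_regHungS : RegHungS → RateLawsHalfQ → crux` (candidate v9q composition; with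
`…R3Lens1CoverageR` landed, `RegHung9S` := binders of `RegRes8S` verbatim ∧ ¬`HungBox`).  ¬`HungBox` geometrically (NODE v10): every couple in
range is covered by the disc of an OUT-OF-BAND mate reaching below the level-`(j+1)` region, or edge-connected to such a disc / to the range
boundary through `{Im z · Im (F′/F)(z) ≥ 0}` — the «exile lens».
-/

namespace RhW08.Lens1SignCut

open Complex Set
open scoped ComplexConjugate
open Literature.Analysis.Complex
open Summit.RiemannHypothesis.RiemannHypothesis.Theorems.Splittings.JensenWindow
open RhIdea6.G17.W07C7 RhIdea6.G17.W07C7.Rev6 RhIdea6.G18.W07C8.Law421BirthS RhIdea6.G19.W07C11.Seam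
open RhIdea6.G20.W07C12.Frac RhIdea6.G20.W07C12.StColP RhW07.C12.FieldSplit RhIdea6.G21.W07C13.TentMax
open RhW07.C14.TwoSided RhW07.C14.Classes RhW07.C14.Lineage RhW07.C14.Booking
open RhW07.C13.Heredity RhIdea6.G22.W07C15pre.Injection RhW07.E3.Cell RhW07.E3.Lit
open RhW08.Round1 RhW08.StSwap RhW08.Round2 RhW08.QuadW RhW08.SealSwapQ RhW08.SealSwap RhW08.SuccB RhW08.SuccSplit
open RhW08.SuccTheft RhW08.Column RhW08.Hurwitz RhW08.ClusterQ RhW08.ClusterQM RhW08.NewtonDoor RhW08.NewtonDoorGenusOne RhW08.PurseP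
open RhW08.AntiEscapeSplit7 RhW08.Lens1Coverage RhW08.LineageQ

/-! ## §1 Signed rectangles and the signed-corner socket -/

/-- ★ SIGNED RECTANGLE `[α, β] × [−H, H]` for `F`: `α < β`, `0 < H`, `F·F′ ≠ 0` at the two real corners, and the Jensen–Kim boundary sign
`Im (F′/F) < 0` on the UPPER boundary (top edge `Im = H` over `[α, β]`, the two sides on heights `(0, H]`; the lower boundary follows by
conjugation for real `F`).  These are exactly the first nine conjuncts of the seam's `SignWindow` (which adds `LocalA` and a couple). -/
def SignedRect (F : ℂ → ℂ) (α β H : ℝ) : Prop :=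
  α < β ∧ 0 < H ∧ F α ≠ 0 ∧ F β ≠ 0 ∧ deriv F α ≠ 0 ∧ deriv F β ≠ 0 ∧
    (∀ x ∈ Icc α β, (deriv F ((x : ℂ) + (H : ℂ) * I) / F ((x : ℂ) + (H : ℂ) * I)).im < 0) ∧
    (∀ y ∈ Ioc (0 : ℝ) H, (deriv F ((α : ℂ) + (y : ℂ) * I) / F ((α : ℂ) + (y : ℂ) * I)).im < 0) ∧
    (∀ y ∈ Ioc (0 : ℝ) H, (deriv F ((β : ℂ) + (y : ℂ) * I) / F ((β : ℂ) + (y : ℂ) * I)).im < 0)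

/-- ★★ SOCKET «signed corner box at level `j`»: a signed rectangle of `f^{(j)}` with a couple inside whose two top corners satisfy the
level-`(j+1)` band inequality `(max(|α − x₀|, |β − x₀|) − R/2)₊² + (j+1)·min(H, Hs)² ≤ (j+1)·Hs²` — the tree's `CornerWindow`
(`…R3AntiEscapeSplit7`) with the Jensen-clear `Window` replaced by `SignedRect`. -/
def SignedCorner (f : ℂ → ℂ) (x₀ R Hs : ℝ) (j : ℕ) : Prop :=
  ∃ α β H : ℝ, SignedRect (iteratedDeriv j f) α β H ∧
    (∃ u ∈ Ioo α β ×ℂ Ioo (-H) H, iteratedDeriv j f u = 0 ∧ u.im ≠ 0) ∧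
    (max (max |α - x₀| |β - x₀| - R / 2) 0) ^ 2 + ((j : ℝ) + 1) * (min H Hs) ^ 2 ≤ ((j : ℝ) + 1) * Hs ^ 2

/-! ## §2 The doors: hung boxes and signed corners -/

/-- From `c · a < 0` and `0 < c`: `a < 0`. -/
private theorem neg_of_pos_mul_neg {c a : ℝ} (hc : 0 < c) (h : c * a < 0) : a < 0 :=
  lt_of_not_ge fun h0 => absurd h (not_lt.2 (mul_nonneg hc.le h0))

/-- ★ A signed rectangle of `f^{(j)}` in the LAW's range WITH local A and a couple is a `WindowReady` datum at level `j` (seam 06). -/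
theorem windowReady_of_signedRect {η : ℝ} {f : ℂ → ℂ} {x₀ s hmax R Hs : ℝ} {B j : ℕ} (v : ℂ) {α β H : ℝ}
    (hα : x₀ - ((j : ℝ) + 3) * R / 2 ≤ α) (hβ : β ≤ x₀ + ((j : ℝ) + 3) * R / 2) (hR : SignedRect (iteratedDeriv j f) α β H)
    (hA : LocalA (iteratedDeriv j f) α β H) (hJ : ∃ u ∈ Ioo α β ×ℂ Ioo (-H) H, iteratedDeriv j f u = 0 ∧ u.im ≠ 0) :
    WindowReady η f x₀ s hmax R Hs B j v :=
  ⟨α, β, H, hα, hβ, hR.1, hR.2.1, hR.2.2.1, hR.2.2.2.1, hR.2.2.2.2.1, hR.2.2.2.2.2.1, hR.2.2.2.2.2.2.1,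
    hR.2.2.2.2.2.2.2.1, hR.2.2.2.2.2.2.2.2, hA, hJ⟩

/-- ★★ THE DICHOTOMY.  A signed rectangle of `f^{(j)}` in range with a couple inside: EITHER an off-axis zero of `f^{(j+1)}` lies in the
OPEN box, OR the box is a `WindowReady` datum at level `j` (`by_cases LocalA`; no census, no Rolle identity, no NL event, no clearance). -/
theorem offAxisZero_or_windowReady {η : ℝ} {f : ℂ → ℂ} {x₀ s hmax R Hs : ℝ} {B j : ℕ} (v : ℂ) {α β H : ℝ}
    (hα : x₀ - ((j : ℝ) + 3) * R / 2 ≤ α) (hβ : β ≤ x₀ + ((j : ℝ) + 3) * R / 2) (hR : SignedRect (iteratedDeriv j f) α β H)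
    (hJ : ∃ u ∈ Ioo α β ×ℂ Ioo (-H) H, iteratedDeriv j f u = 0 ∧ u.im ≠ 0) :
    (∃ ρ ∈ Ioo α β ×ℂ Ioo (-H) H, iteratedDeriv (j + 1) f ρ = 0 ∧ ρ.im ≠ 0) ∨ WindowReady η f x₀ s hmax R Hs B j v := by
  by_cases hA : LocalA (iteratedDeriv j f) α β H
  · exact Or.inr (windowReady_of_signedRect v hα hβ hR hA hJ)
  · exact Or.inl (Classical.byContradiction fun hno => hA fun ρ hρ hdρ =>
      Classical.byContradiction fun him => hno ⟨ρ, hρ, by rw [iteratedDeriv_succ]; exact hdρ, him⟩)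

/-- ★ HANG CLAUSE of a box at level `j`: every point of the UPPER open box lying in the closed Jensen disc of an upper zero `a` of `F` satisfies
the level-`(j+1)` band inequality.  Free for hosts `a` that are level-`j` band points (`hangClause_of_inBand`, Jensen nesting `band_step'`) and
for boxes inside the level-`(j+1)` corner region (`hangClause_of_corner`); it only constrains OUT-OF-BAND hosts whose discs reach into the box. -/
def HangClause (F : ℂ → ℂ) (x₀ R Hs : ℝ) (j : ℕ) (α β H : ℝ) : Prop :=
  ∀ a z : ℂ, F a = 0 → 0 < a.im → z ∈ Ioo α β ×ℂ Ioo 0 H → (z.re - a.re) ^ 2 + z.im ^ 2 ≤ a.im ^ 2 →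
    (max (|z.re - x₀| - R / 2) 0) ^ 2 + ((j : ℝ) + 1) * z.im ^ 2 ≤ ((j : ℝ) + 1) * Hs ^ 2

/-- ★★ SOCKET «hung signed box at level `j`»: a signed rectangle of `f^{(j)}` in the LAW's range `|x − x₀| ≤ (j+3)R/2`, a couple inside, and
the hang clause.  No corner inequality, no size restriction, mixed members allowed. -/
def HungBox (f : ℂ → ℂ) (x₀ R Hs : ℝ) (j : ℕ) : Prop :=
  ∃ α β H : ℝ, x₀ - ((j : ℝ) + 3) * R / 2 ≤ α ∧ β ≤ x₀ + ((j : ℝ) + 3) * R / 2 ∧ SignedRect (iteratedDeriv j f) α β H ∧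
    (∃ u ∈ Ioo α β ×ℂ Ioo (-H) H, iteratedDeriv j f u = 0 ∧ u.im ≠ 0) ∧ HangClause (iteratedDeriv j f) x₀ R Hs j α β H

/-- ★★★ THE HUNG-BOX DOOR.  Legal frame, band state at level `j`, a hung signed box of `f^{(j)}` ⇒ a level-`(j+1)` band state OR `ReadyR2` at
level `j`.  Proof: the dichotomy gives an off-axis zero `ρ` of `f^{(j+1)}` in the open box (or `WindowReady`); reflect it up; by JENSEN'S THEOREM
at level `j` (tree `jensen_host_levelj`) it hangs in the closed disc of an upper zero `a` of `f^{(j)}`; the hang clause puts it in the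
level-`(j+1)` band (`succ_of_nonreal_zero_inBand`). -/
theorem succ_or_readyR2_of_hungBox {η : ℝ} {f : ℂ → ℂ} {x₀ s hmax R Hs : ℝ} {B j : ℕ} {v : ℂ}
    (hE : EngineHyps5 2 η f x₀ s hmax R Hs B) (hv : StTrkDQ η f x₀ s hmax R Hs B j v) (hB : HungBox f x₀ R Hs j) :
    (∃ u : ℂ, StTrkDQ η f x₀ s hmax R Hs B (j + 1) u) ∨ ReadyR2 η f x₀ s hmax R Hs B j v := by
  obtain ⟨α, β, H, hα, hβ, hR, hJ, hH⟩ := hB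
  rcases offAxisZero_or_windowReady v hα hβ hR hJ with ⟨ρ, hρ, hz, hρim⟩ | hW
  · left
    rw [mem_reProdIm] at hρ
    obtain ⟨u, hu, hup, hure, huim⟩ := exists_upper_zero_of_nonreal hE.1 hE.2.1 (j + 1) hz hρim
    obtain ⟨c, -, hc, -⟩ := hJ
    obtain ⟨a, ha, hapos, hdisc⟩ := jensen_host_levelj (realEntireLt2_of_hyps hE) j hv.1 hc hup hu
    have huBox : u ∈ Ioo α β ×ℂ Ioo 0 H := by
      rw [mem_reProdIm, hure]
      refine ⟨hρ.1, hup, ?_⟩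
      have : |u.im| < H := by rw [huim]; exact abs_lt.2 ⟨hρ.2.1, hρ.2.2⟩
      exact lt_of_le_of_lt (le_abs_self _) this
    exact succ_of_nonreal_zero_inBand hE hv hu hup.ne' (hH a u ha hapos huBox hdisc)
  · exact Or.inr (cumReady_of_ready (Ready := WinOrTilt) (Or.inl hW))

/-- ★ The `AntiEscapeCore`-shaped instance: at a non-Ready′ level a hung signed box yields the successor level. -/
theorem succ_of_hungBox {η : ℝ} {f : ℂ → ℂ} {x₀ s hmax R Hs : ℝ} {B j : ℕ} {v : ℂ}
    (hE : EngineHyps5 2 η f x₀ s hmax R Hs B) (hv : StTrkDQ η f x₀ s hmax R Hs B j v) (hnR : ¬ ReadyR2 η f x₀ s hmax R Hs B j v)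
    (hB : HungBox f x₀ R Hs j) : ∃ u : ℂ, StTrkDQ η f x₀ s hmax R Hs B (j + 1) u :=
  (succ_or_readyR2_of_hungBox hE hv hB).resolve_right hnR

/-- ★ In-band hosts hang for free: if every upper zero of `F = f^{(j)}` whose closed disc meets the upper open box satisfies the level-`j`
band inequality, the hang clause holds (Jensen nesting, tree `band_step'`; `Im a ≤ Hs` by strip heredity). -/
theorem hangClause_of_inBand {η : ℝ} {f : ℂ → ℂ} {x₀ s hmax R Hs : ℝ} {B j : ℕ} (hE : EngineHyps5 2 η f x₀ s hmax R Hs B)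
    (hnz : iteratedDeriv j f ≠ 0) {α β H : ℝ}
    (h : ∀ a : ℂ, iteratedDeriv j f a = 0 → 0 < a.im → (∃ z ∈ Ioo α β ×ℂ Ioo 0 H, (z.re - a.re) ^ 2 + z.im ^ 2 ≤ a.im ^ 2) →
      (max (|a.re - x₀| - R / 2) 0) ^ 2 + (j : ℝ) * a.im ^ 2 ≤ (j : ℝ) * Hs ^ 2) :
    HangClause (iteratedDeriv j f) x₀ R Hs j α β H := by
  intro a z ha hapos hz hdisc
  have haHs : a.im ^ 2 ≤ Hs ^ 2 := by
    have h1 := abs_im_le_of_level hE hnz ha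
    rw [abs_of_pos hapos] at h1
    nlinarith
  exact band_step' (h a ha hapos ⟨z, hz, hdisc⟩) haHs (by unfold NestedStep; linarith)

/-- The corner inequality puts the box base laterally inside the LAW's range: `max(|α − x₀|, |β − x₀|) < (j+3)R/2` (tree `range_of_lateral`). -/
theorem lateral_lt_of_corner {η : ℝ} {f : ℂ → ℂ} {x₀ s hmax R Hs : ℝ} {B j : ℕ} (hE : EngineHyps5 2 η f x₀ s hmax R Hs B)
    {α β H : ℝ}
    (hcorner : (max (max |α - x₀| |β - x₀| - R / 2) 0) ^ 2 + ((j : ℝ) + 1) * (min H Hs) ^ 2 ≤ ((j : ℝ) + 1) * Hs ^ 2) :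
    x₀ - ((j : ℝ) + 3) * R / 2 ≤ α ∧ β ≤ x₀ + ((j : ℝ) + 3) * R / 2 := by
  set M : ℝ := max |α - x₀| |β - x₀| with hMdef
  have hM0 : 0 ≤ M := le_trans (abs_nonneg _) (le_max_left _ _)
  have e : |(x₀ + M) - x₀| = M := by rw [show (x₀ + M) - x₀ = M by ring, abs_of_nonneg hM0]
  have hlat : (max (|(x₀ + M) - x₀| + 0 - R / 2) 0) ^ 2 + ((j : ℝ) + 1) * (0 : ℝ) ^ 2 ≤ ((j : ℝ) + 1) * Hs ^ 2 := by
    rw [e, add_zero]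
    have : 0 ≤ ((j : ℝ) + 1) * (min H Hs) ^ 2 := by positivity
    nlinarith
  have hrange := range_of_lateral (j := j) hE hlat
  rw [e, add_zero] at hrange
  have h1 : |α - x₀| ≤ M := le_max_left _ _
  have h2 : |β - x₀| ≤ M := le_max_right _ _
  exact ⟨by linarith [neg_abs_le (α - x₀)], by linarith [le_abs_self (β - x₀)]⟩

/-- ★ Boxes inside the level-`(j+1)` corner region hang for free: the corner inequality implies the hang clause (monotonicity in `|Re − x₀|`,
`Im z ≤ Im a ≤ Hs` by strip heredity, `Im z < H`). -/
theorem hangClause_of_corner {η : ℝ} {f : ℂ → ℂ} {x₀ s hmax R Hs : ℝ} {B j : ℕ} (hE : EngineHyps5 2 η f x₀ s hmax R Hs B)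
    (hnz : iteratedDeriv j f ≠ 0) {α β H : ℝ}
    (hcorner : (max (max |α - x₀| |β - x₀| - R / 2) 0) ^ 2 + ((j : ℝ) + 1) * (min H Hs) ^ 2 ≤ ((j : ℝ) + 1) * Hs ^ 2) :
    HangClause (iteratedDeriv j f) x₀ R Hs j α β H := by
  intro a z ha hapos hz hdisc
  rw [mem_reProdIm] at hz
  have hsq : (max (|z.re - x₀| - R / 2) 0) ^ 2 ≤ (max (max |α - x₀| |β - x₀| - R / 2) 0) ^ 2 :=
    pow_le_pow_left₀ (le_max_right _ _) (max_le_max (by linarith [abs_sub_le_max_of_mem_Ioo (x₀ := x₀) hz.1]) le_rfl) 2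
  have haHs : a.im ≤ Hs := by have h1 := abs_im_le_of_level hE hnz ha; rwa [abs_of_pos hapos] at h1
  have hza : z.im ≤ a.im := by nlinarith [hz.2.1, sq_nonneg (z.re - a.re)]
  have hmin : z.im ≤ min H Hs := le_min hz.2.2.le (le_trans hza haHs)
  have him2 : z.im ^ 2 ≤ (min H Hs) ^ 2 := pow_le_pow_left₀ hz.2.1.le hmin 2
  have hj : (0 : ℝ) ≤ (j : ℝ) + 1 := by positivity
  nlinarith [mul_le_mul_of_nonneg_left him2 hj]

/-- ★ A signed corner box is a hung box (`lateral_lt_of_corner`, `hangClause_of_corner`). -/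
theorem hungBox_of_signedCorner {η : ℝ} {f : ℂ → ℂ} {x₀ s hmax R Hs : ℝ} {B j : ℕ} (hE : EngineHyps5 2 η f x₀ s hmax R Hs B)
    (hnz : iteratedDeriv j f ≠ 0) (hS : SignedCorner f x₀ R Hs j) : HungBox f x₀ R Hs j := by
  obtain ⟨α, β, H, hR, hJ, hcorner⟩ := hS
  obtain ⟨hα, hβ⟩ := lateral_lt_of_corner (j := j) (H := H) hE hcorner
  exact ⟨α, β, H, hα, hβ, hR, hJ, hangClause_of_corner hE hnz hcorner⟩

/-- ★★ THE SIGNED-CORNER DOOR (corollary).  Legal frame, band state at level `j`, a signed corner box of `f^{(j)}` ⇒ a level-`(j+1)` band state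
OR `ReadyR2` at level `j`.  No census, no Rolle identity, no NL event, no Jensen clearance. -/
theorem succ_or_readyR2_of_signedCorner {η : ℝ} {f : ℂ → ℂ} {x₀ s hmax R Hs : ℝ} {B j : ℕ} {v : ℂ}
    (hE : EngineHyps5 2 η f x₀ s hmax R Hs B) (hv : StTrkDQ η f x₀ s hmax R Hs B j v) (hS : SignedCorner f x₀ R Hs j) :
    (∃ u : ℂ, StTrkDQ η f x₀ s hmax R Hs B (j + 1) u) ∨ ReadyR2 η f x₀ s hmax R Hs B j v :=
  succ_or_readyR2_of_hungBox hE hv (hungBox_of_signedCorner hE hv.1 hS)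

/-- ★ At a non-Ready′ level a signed corner box yields the successor level. -/
theorem succ_of_signedCorner {η : ℝ} {f : ℂ → ℂ} {x₀ s hmax R Hs : ℝ} {B j : ℕ} {v : ℂ}
    (hE : EngineHyps5 2 η f x₀ s hmax R Hs B) (hv : StTrkDQ η f x₀ s hmax R Hs B j v) (hnR : ¬ ReadyR2 η f x₀ s hmax R Hs B j v)
    (hS : SignedCorner f x₀ R Hs j) : ∃ u : ℂ, StTrkDQ η f x₀ s hmax R Hs B (j + 1) u :=
  (succ_or_readyR2_of_signedCorner hE hv hS).resolve_right hnR

/-! ## §3 The signed door generalises the Jensen-clear corner door of the tree -/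

/-- At a Jensen-CLEAR off-axis point of `f^{(j)}` (with `f^{(j)}` having a zero) the boundary sign holds: `Im w · Im (F′/F)(w) < 0`
(tree `im_mul_im_logDeriv_neg`, Kim 1996 (2.3)). -/
theorem sgn_of_jensenClear {f : ℂ → ℂ} (hf : RealEntireLt2 f) (j : ℕ) (hex : ∃ a, iteratedDeriv j f a = 0)
    {w : ℂ} (hw : w.im ≠ 0) (hc : JensenClear (iteratedDeriv j f) w) :
    w.im * (deriv (iteratedDeriv j f) w / iteratedDeriv j f w).im < 0 := by
  have hG := RhW08.WindowLoss.realEntireLt2_iteratedDeriv hf j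
  obtain ⟨ρ, C, hρ0, hρ, hgr⟩ := hG.growth
  exact im_mul_im_logDeriv_neg hG.diff hρ0 hρ hgr hG.real hex hw hc

/-- ★ A Jensen-clear `Window` of `f^{(j)}` (with `f^{(j)}` having a zero) is a signed rectangle. -/
theorem signedRect_of_window {f : ℂ → ℂ} (hf : RealEntireLt2 f) (j : ℕ) {α β H : ℝ}
    (hW : Window (iteratedDeriv j f) α β H) (hex : ∃ a, iteratedDeriv j f a = 0) :
    SignedRect (iteratedDeriv j f) α β H := by
  have imS : ∀ a y : ℝ, ((a : ℂ) + (y : ℂ) * I).im = y := by intro a y; simp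
  have sgn : ∀ a y : ℝ, 0 < y → JensenClear (iteratedDeriv j f) ((a : ℂ) + (y : ℂ) * I) →
      (deriv (iteratedDeriv j f) ((a : ℂ) + (y : ℂ) * I) / iteratedDeriv j f ((a : ℂ) + (y : ℂ) * I)).im < 0 := by
    intro a y hy hc
    have h1 := sgn_of_jensenClear hf j hex (w := (a : ℂ) + (y : ℂ) * I) (by rw [imS]; exact hy.ne') hc
    rw [imS] at h1
    exact neg_of_pos_mul_neg hy h1
  have hyI : ∀ y ∈ Ioc (0 : ℝ) H, y ∈ Icc (-H) H := fun y hy => ⟨by linarith [hy.1, hW.pos], hy.2⟩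
  exact ⟨hW.lt, hW.pos, hW.fα, hW.fβ, hW.dα, hW.dβ, fun x hx => sgn x H hW.pos (hW.top x hx),
    fun y hy => sgn α y hy.1 (hW.left y (hyI y hy) hy.1.ne'), fun y hy => sgn β y hy.1 (hW.right y (hyI y hy) hy.1.ne')⟩

/-- ★ `CornerWindow ⇒ SignedCorner` on a legal frame: the signed door contains the tree's corner-window door (A8 of `DoorAvailLawQ8`). -/
theorem signedCorner_of_cornerWindow {η : ℝ} {f : ℂ → ℂ} {x₀ s hmax R Hs : ℝ} {B j : ℕ} (hE : EngineHyps5 2 η f x₀ s hmax R Hs B)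
    (hW : CornerWindow f x₀ R Hs j) : SignedCorner f x₀ R Hs j := by
  obtain ⟨α, β, h, hWin, hJ, hcorner⟩ := hW
  have hex : ∃ a, iteratedDeriv j f a = 0 := hJ.elim fun u hu => ⟨u, hu.2.1⟩
  exact ⟨α, β, h, signedRect_of_window (realEntireLt2_of_hyps hE) j hWin hex, hJ, hcorner⟩

/-! ## §4 The free top: column transversals -/

/-- Above the strip every point is Jensen-clear for `f^{(j)}`: all zeros of `f^{(j)} ≢ 0` have `|Im| ≤ Hs` (strip heredity
`abs_im_le_of_level`), and `|Im w| ≤ ‖w − Re a‖`. -/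
theorem jensenClear_of_gt_strip {η : ℝ} {f : ℂ → ℂ} {x₀ s hmax R Hs : ℝ} {B j : ℕ} (hE : EngineHyps5 2 η f x₀ s hmax R Hs B)
    (hnz : iteratedDeriv j f ≠ 0) {w : ℂ} (hw : Hs < |w.im|) : JensenClear (iteratedDeriv j f) w := by
  intro a ha _
  have h1 : |a.im| ≤ Hs := abs_im_le_of_level hE hnz ha
  have h3 := Complex.abs_im_le_norm (w - (a.re : ℂ))
  rw [show (w - (a.re : ℂ)).im = w.im by simp] at h3
  linarith

/-- ★ Two vertical transversals `α < β` signed on heights `(0, Hs]` with `F·F′ ≠ 0` at their feet span a signed rectangle of height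
`Hs + 1`: the top edge and the side segments above the strip are signed for free (`jensenClear_of_gt_strip`). -/
theorem signedRect_of_cuts {η : ℝ} {f : ℂ → ℂ} {x₀ s hmax R Hs : ℝ} {B j : ℕ} (hE : EngineHyps5 2 η f x₀ s hmax R Hs B)
    (hnz : iteratedDeriv j f ≠ 0) (hex : ∃ a, iteratedDeriv j f a = 0) {α β : ℝ} (hlt : α < β)
    (hFα : iteratedDeriv j f α ≠ 0) (hFβ : iteratedDeriv j f β ≠ 0)
    (hdα : deriv (iteratedDeriv j f) α ≠ 0) (hdβ : deriv (iteratedDeriv j f) β ≠ 0)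
    (hsα : ∀ y ∈ Ioc (0 : ℝ) Hs,
      (deriv (iteratedDeriv j f) ((α : ℂ) + (y : ℂ) * I) / iteratedDeriv j f ((α : ℂ) + (y : ℂ) * I)).im < 0)
    (hsβ : ∀ y ∈ Ioc (0 : ℝ) Hs,
      (deriv (iteratedDeriv j f) ((β : ℂ) + (y : ℂ) * I) / iteratedDeriv j f ((β : ℂ) + (y : ℂ) * I)).im < 0) :
    SignedRect (iteratedDeriv j f) α β (Hs + 1) := by
  have hH : 0 < Hs + 1 := by linarith [hE.2.2.2.2.2.2.2.1]
  have imS : ∀ a y : ℝ, ((a : ℂ) + (y : ℂ) * I).im = y := by intro a y; simp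
  have sgn : ∀ a y : ℝ, Hs < y →
      (deriv (iteratedDeriv j f) ((a : ℂ) + (y : ℂ) * I) / iteratedDeriv j f ((a : ℂ) + (y : ℂ) * I)).im < 0 := by
    intro a y hy
    have hy0 : 0 < y := lt_of_le_of_lt hE.2.2.2.2.2.2.2.1 hy
    have h1 := sgn_of_jensenClear (realEntireLt2_of_hyps hE) j hex (w := (a : ℂ) + (y : ℂ) * I) (by rw [imS]; exact hy0.ne')
      (jensenClear_of_gt_strip hE hnz (by rw [imS, abs_of_pos hy0]; exact hy))
    rw [imS] at h1
    exact neg_of_pos_mul_neg hy0 h1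
  have side : ∀ a : ℝ,
      (∀ y ∈ Ioc (0 : ℝ) Hs, (deriv (iteratedDeriv j f) ((a : ℂ) + (y : ℂ) * I) / iteratedDeriv j f ((a : ℂ) + (y : ℂ) * I)).im < 0) →
      ∀ y ∈ Ioc (0 : ℝ) (Hs + 1),
        (deriv (iteratedDeriv j f) ((a : ℂ) + (y : ℂ) * I) / iteratedDeriv j f ((a : ℂ) + (y : ℂ) * I)).im < 0 := by
    intro a hs y hy
    by_cases hyle : y ≤ Hs
    · exact hs y ⟨hy.1, hyle⟩
    · exact sgn a y (lt_of_not_ge hyle)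
  exact ⟨hlt, hH, hFα, hFβ, hdα, hdβ, fun x _ => sgn x (Hs + 1) (by linarith), side α hsα, side β hsβ⟩

/-- A zero of `f^{(j)} ≢ 0` with `α < Re u < β` lies in the open box `(α, β) × (−(Hs+1), Hs+1)` (strip heredity). -/
theorem mem_box_of_zero {η : ℝ} {f : ℂ → ℂ} {x₀ s hmax R Hs : ℝ} {B j : ℕ} (hE : EngineHyps5 2 η f x₀ s hmax R Hs B)
    (hnz : iteratedDeriv j f ≠ 0) {u : ℂ} (hu : iteratedDeriv j f u = 0) {α β : ℝ} (huα : α < u.re) (huβ : u.re < β) :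
    u ∈ Ioo α β ×ℂ Ioo (-(Hs + 1)) (Hs + 1) := by
  have huHs : |u.im| ≤ Hs := abs_im_le_of_level hE hnz hu
  rw [mem_reProdIm]
  exact ⟨⟨huα, huβ⟩, by linarith [neg_abs_le u.im], by linarith [le_abs_self u.im]⟩

/-! ## §4b The central lineage: column-cuttable levels propagate a column couple (state-free, `v`-free) -/

/-- A COLUMN COUPLE at level `j`: an off-axis zero of `f^{(j)}` with real part inside the open column `|Re − x₀| < R/2`.  At level 0 the
frame's booked pair `w₀` (`Re w₀ = x₀`) is one. -/
def ColCouple (f : ℂ → ℂ) (x₀ R : ℝ) (j : ℕ) : Prop :=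
  ∃ c : ℂ, iteratedDeriv j f c = 0 ∧ c.im ≠ 0 ∧ |c.re - x₀| < R / 2

/-- ★ SOCKET «level `j` is COLUMN-CUTTABLE»: every column couple `c` of `F = f^{(j)}` is bracketed, inside the closed column, by two
vertical transversals `α < Re c < β` signed on heights `(0, Hs]` with `F·F′ ≠ 0` at their feet.  (Fails iff some column couple is
edge-connected, through the set where the boundary sign fails at some height `≤ Hs`, to a column wall `Re = x₀ ± R/2`.) -/
def ColumnCuttable (f : ℂ → ℂ) (x₀ R Hs : ℝ) (j : ℕ) : Prop :=
  ∀ c : ℂ, iteratedDeriv j f c = 0 → c.im ≠ 0 → |c.re - x₀| < R / 2 →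
    ∃ α β : ℝ, x₀ - R / 2 ≤ α ∧ β ≤ x₀ + R / 2 ∧ α < c.re ∧ c.re < β ∧
      iteratedDeriv j f α ≠ 0 ∧ iteratedDeriv j f β ≠ 0 ∧
      deriv (iteratedDeriv j f) α ≠ 0 ∧ deriv (iteratedDeriv j f) β ≠ 0 ∧
      (∀ y ∈ Ioc (0 : ℝ) Hs, (deriv (iteratedDeriv j f) ((α : ℂ) + (y : ℂ) * I) / iteratedDeriv j f ((α : ℂ) + (y : ℂ) * I)).im < 0) ∧
      (∀ y ∈ Ioc (0 : ℝ) Hs, (deriv (iteratedDeriv j f) ((β : ℂ) + (y : ℂ) * I) / iteratedDeriv j f ((β : ℂ) + (y : ℂ) * I)).im < 0)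

/-- ★ LINEAGE STEP: legal frame, `f^{(j)} ≢ 0`, a column couple at level `j`, level `j` column-cuttable and NOT `WindowReady` ⇒ a column
couple at level `j+1` (the off-axis zero of `f^{(j+1)}` that ¬ local A puts in the open cut box, `offAxisZero_or_windowReady`). -/
theorem colCouple_succ_of_cuttable {η : ℝ} {f : ℂ → ℂ} {x₀ s hmax R Hs : ℝ} {B j : ℕ} (v : ℂ)
    (hE : EngineHyps5 2 η f x₀ s hmax R Hs B) (hnz : iteratedDeriv j f ≠ 0) (hP : ColCouple f x₀ R j)
    (hcut : ColumnCuttable f x₀ R Hs j) (hnW : ¬ WindowReady η f x₀ s hmax R Hs B j v) : ColCouple f x₀ R (j + 1) := by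
  obtain ⟨c, hc, hcim, hccol⟩ := hP
  obtain ⟨α, β, hα, hβ, hαc, hcβ, hFα, hFβ, hdα, hdβ, hsα, hsβ⟩ := hcut c hc hcim hccol
  have hlt : α < β := lt_trans hαc hcβ
  have hH : 0 < Hs + 1 := by linarith [hE.2.2.2.2.2.2.2.1]
  have hR := signedRect_of_cuts hE hnz ⟨c, hc⟩ hlt hFα hFβ hdα hdβ hsα hsβ
  have hJ : ∃ u ∈ Ioo α β ×ℂ Ioo (-(Hs + 1)) (Hs + 1), iteratedDeriv j f u = 0 ∧ u.im ≠ 0 :=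
    ⟨c, mem_box_of_zero hE hnz hc hαc hcβ, hc, hcim⟩
  obtain ⟨hα', hβ'⟩ := lateral_lt_of_corner (j := j) (H := Hs + 1) hE (corner_of_columnBase (j := j) hlt hH hα hβ)
  rcases offAxisZero_or_windowReady v hα' hβ' hR hJ with ⟨ρ, hρ, hz, hρim⟩ | hW
  · rw [mem_reProdIm] at hρ
    exact ⟨ρ, hz, hρim, abs_lt.2 ⟨by linarith [hρ.1.1], by linarith [hρ.1.2]⟩⟩
  · exact absurd hW hnW

/-- ★★ COLUMN-CUT DOOR (one level, state-free): legal frame, level `j` not Ready′, a column couple at level `j`, level `j` column-cuttable ⇒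
the level-`(j+1)` band is inhabited (the propagated column couple is a band state by column immunity `stTrkDQ_of_column`). -/
theorem succ_of_columnCuttable {η : ℝ} {f : ℂ → ℂ} {x₀ s hmax R Hs : ℝ} {B j : ℕ} (v : ℂ)
    (hE : EngineHyps5 2 η f x₀ s hmax R Hs B) (hnR : ¬ ReadyR2 η f x₀ s hmax R Hs B j v) (hP : ColCouple f x₀ R j)
    (hcut : ColumnCuttable f x₀ R Hs j) : ∃ u : ℂ, StTrkDQ η f x₀ s hmax R Hs B (j + 1) u := by
  have hnz := iteratedDeriv_ne_zero_of_not_readyR2 hE j v hnR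
  have hnW : ¬ WindowReady η f x₀ s hmax R Hs B j v := fun hW => hnR (cumReady_of_ready (Ready := WinOrTilt) (Or.inl hW))
  obtain ⟨c, hc, hcim, hccol⟩ := colCouple_succ_of_cuttable v hE hnz.1 hP hcut hnW
  obtain ⟨u, hu, hup, hure, -⟩ := exists_upper_zero_of_nonreal hE.1 hE.2.1 (j + 1) hc hcim
  exact ⟨u, stTrkDQ_of_column hE hnz.2 hu hup (by rw [hure]; exact hccol.le)⟩

/-- ★★ THE CENTRAL-LINEAGE DOOR (state-free).  Legal frame, level `j` not Ready′, every level `j' ≤ j` column-cuttable ⇒ the level-`(j+1)` band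
is inhabited: induction from the booked pair `w₀` (a column couple at level 0) via `colCouple_succ_of_cuttable`, then `succ_of_columnCuttable`. -/
theorem succ_of_columnCuttable_upTo {η : ℝ} {f : ℂ → ℂ} {x₀ s hmax R Hs : ℝ} {B j : ℕ} (v : ℂ)
    (hE : EngineHyps5 2 η f x₀ s hmax R Hs B) (hnR : ¬ ReadyR2 η f x₀ s hmax R Hs B j v)
    (hcut : ∀ j', j' ≤ j → ColumnCuttable f x₀ R Hs j') : ∃ u : ℂ, StTrkDQ η f x₀ s hmax R Hs B (j + 1) u := by
  have hRpos : 0 < R := R_pos_of_engine hE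
  have P : ∀ k, k ≤ j → ColCouple f x₀ R k := by
    intro k
    induction k with
    | zero =>
      intro _
      obtain ⟨w₀, hw₀, hw₀im, hw₀re, -⟩ := hE.2.2.2.2.2.2.2.2.2.2.1
      exact ⟨w₀, by rw [iteratedDeriv_zero]; exact hw₀, hw₀im, by rw [hw₀re, sub_self, abs_zero]; linarith⟩
    | succ k ih =>
      intro hk
      have hnRk : ¬ ReadyR2 η f x₀ s hmax R Hs B k v := fun h => hnR (readyR2_mono h (by omega))
      have hnW : ¬ WindowReady η f x₀ s hmax R Hs B k v := fun hW => hnRk (cumReady_of_ready (Ready := WinOrTilt) (Or.inl hW))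
      exact colCouple_succ_of_cuttable v hE (iteratedDeriv_ne_zero_of_not_readyR2 hE k v hnRk).1 (ih (by omega)) (hcut k (by omega)) hnW
  exact succ_of_columnCuttable v hE hnR (P j le_rfl) (hcut j le_rfl)

/-! ## §5 The residuals in SUCCESSOR currency and the compositions -/

/-- ★ THE HUNG RESIDUAL `RegHungS` (OPEN; successor currency; the candidate v9q SUCC stub).  On a legal frame, at a level `j` whose lowest band
state `v` is not Ready′, not in an all-in-band window, undimpled, disc-overlapped, a simple zero, outside the proved cells F / N♭ / L-deep of
`…R3Lens1CoverageB`, and such that `f^{(j)}` admits NO hung signed box at level `j` (¬ `HungBox`), a level-`(j+1)` band state still exists.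
WHY IT MIGHT FAIL: the «exile lens» — `v` laterally saturated, covered by the disc of a taller OUT-OF-BAND mate with no real zero between,
children nested under the mate only.  (With `…R3Lens1CoverageR` landed, `RegHung9S` adds the binders `¬ LandingDipW`, `¬ IsolatedNewtonL`.) -/
def RegHungS : Prop :=
  ∀ (η : ℝ) (f : ℂ → ℂ) (x₀ s hmax R Hs : ℝ) (B : ℕ), EngineHyps5 2 η f x₀ s hmax R Hs B → ∀ (j : ℕ) (v : ℂ),
    IsLowest StTrkDQ η f x₀ s hmax R Hs B j v → ¬ ReadyR2 η f x₀ s hmax R Hs B j v →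
    ¬ AllInBandInRangeWindow f x₀ R Hs j v → ¬ Dimple f j v → DiscOverlap f j v →
    iteratedDeriv (j + 1) f v ≠ 0 → ¬ CellF f j v → ¬ CellNb f x₀ R Hs j v → ¬ LandingDipDeep f x₀ R Hs j v →
    ¬ HungBox f x₀ R Hs j →
    ∃ u : ℂ, StTrkDQ η f x₀ s hmax R Hs B (j + 1) u

/-- ★★ COVERAGE BY HUNG BOXES, SUCCESSOR CURRENCY: the hung residual closes `AntiEscapeCore` (multiple zero: `succ_of_multiple`; cells F, N♭,
L-deep: the proved regime lemmas of `…R3Lens1CoverageB`; a hung signed box: `succ_of_hungBox`; else `RegHungS`). -/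
theorem antiEscapeCore_of_regHungS (hC : RegHungS) : AntiEscapeCore := by
  intro η f x₀ s hmax R Hs B hE j v hlow hnR hwin hdim hov
  by_cases hz : iteratedDeriv (j + 1) f v = 0
  · exact succ_of_multiple hE hlow.1 hz
  by_cases hF : CellF f j v
  · exact regime_F hE hlow.1 hF
  by_cases hN : CellNb f x₀ R Hs j v
  · exact regime_Nb hE hlow.1 hN
  by_cases hD : LandingDipDeep f x₀ R Hs j v
  · exact regime_Ldeep hE hD
  by_cases hB : HungBox f x₀ R Hs j
  · exact succ_of_hungBox hE hlow.1 hnR hB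
  exact hC η f x₀ s hmax R Hs B hE j v hlow hnR hwin hdim hov hz hF hN hD hB

/-- (K) `RegHungS ⇒ RestSuccBotQ` (tree `restSuccBotQ_of_pieces` + `antiEscape_of_core`). -/
theorem restSuccBotQ_of_regHungS (hC : RegHungS) : RestSuccBotQ :=
  restSuccBotQ_of_pieces dimpleSig_holds (antiEscape_of_core (antiEscapeCore_of_regHungS hC))

/-- ★★ THE CRUX BY NAME from the hung residual and lens-2's rate law (candidate v9q composition: stubs `RegHungS`, `RateLawsHalfQ`). -/
theorem TiltedLandingLaw421R_of_regHungS (hC : RegHungS) (hR : RhW08.RateSplit.RateLawsHalfQ) :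
    Summit.RiemannHypothesis.RiemannHypothesis.Theses.EarlyAppointments.TiltedLandingLaw421R :=
  law421Half_of_succ_rate (restSuccBotQ_of_regHungS hC) (RhW08.RateSplit.restRateBotPQ_half_of_rateLaws hR)

end RhW08.Lens1SignCut
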